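import Summits.BirchSwinnertonDyer.BirchSwinnertonDyer.Theorems.SignedLowerHalvesSprungLowerDivisibilityAtThreeSlopeSeparationTieRadius
import HarnessLib

/-!
# Crux `SprungLowerDivisibilityAtThree` (item stmt-BirchSwinnertonDyer-19875), line `chromatic-common-zeros`:
# the NEWTON POLYGON of a power series in `Λ = ℤ_p⟦T⟧` IN FULL (every zero radius is an EDGE slope of the lower
# convex hull) and the hull-aware coprimality certificate for two functions — pure `p`-adic algebra, any `p`

Cell `bsd-ssimc` (host) / lead `cruxlead-stmt-BirchSwinnertonDyer-19875`; width seat `-w2` (gen 6); `--supports` 19875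
`--as helper`; THEOREMS ONLY (no definition, no named fact, nothing about any curve); closes no item; BSD / K1 / leaf
X8 are NOT proved by anything here. Sequel of `…SlopeSeparationTieRadius.lean` (w3 g3): there a zero of `G` forces a
tie of SOME pair `i < j ≤ λ(G)` and the door (R8) asks `F` to dominate at the tie radius of EVERY pair with
`‖G_i‖ < ‖G_j‖`, also at non-edges; a non-vertex coefficient known only as a `3`-adic BOUND (`v₃(L^•₁) ≥ 3`) then
spawns spurious radii, some of which tie in `F` (x8 lit g42 census: 108416i1, 210406v1, 477950b1 — all three
numerically `coprime:NP-disjoint` at n = 6). Here, [Ko84] IV §4 in the ROBUST form a census can feed: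

* §1 combinatorics of a vertex list (`exists_vertex_or_interior`, `lt_of_chain_up/down`, log-linear `interior_lt_max`).
* §2 **`exists_edge_of_hasSum_zero`** — HULL DATUM for `G ≠ 0`, `μ(G) = 0`: vertices `n₀ = 0 < ⋯ < n_m = λ(G)` with
  `G_{n_t} ≠ 0`; interior indices ON OR ABOVE the chord, `‖G_k‖^{n_{t+1}−n_t} ≤ ‖G_{n_t}‖^{n_{t+1}−k}‖G_{n_{t+1}}‖^{k−n_t}`
  (an UPPER BOUND on `‖G_k‖` suffices); consecutive slopes non-increasing,
  `‖G_{n_t}‖^{n_{t+2}−n_{t+1}}‖G_{n_{t+2}}‖^{n_{t+1}−n_t} ≤ ‖G_{n_{t+1}}‖^{n_{t+2}−n_t}`. Then every zero `0 < |z| < 1` of `G`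
  lies on an EDGE circle `|z|^{n_{t+1}−n_t}‖G_{n_{t+1}}‖ = ‖G_{n_t}‖`, `t < m`. Proof: otherwise the vertex terms
  `‖G_{n_t}‖|z|^{n_t}` strictly rise then strictly fall along `t` (convexity propagates a descent), interior terms
  lie below a weighted mean of their two vertex terms, so ONE vertex term strictly dominates every index `≤ λ(G)`,
  contradicting `not_hasSum_zero_of_uniqueMax`.
* §3 **`not_common_zero_of_newtonPolygon` / `not_mem_and_mem_of_newtonPolygon` / `…_X_mul_…`** — `μ = 0` both,
  `F(0) ≠ 0`, hull datum for `G`, and the (R8) dominance inequality of `F` at the `m` EDGES `(n_t, n_{t+1})` only ⟹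
  no common zero in the open disc ⟹ no common height-one prime of `Λ`; `T`-shifted form. Doors: `…NewtonPolygonDoor`.

References (ATTRIBUTION): [Koblitz1984] GTM 58, Ch. IV §3 Lemma 4 and §4 (radii of the zeros = slopes of the Newton
polygon); [Washington1997] §7.1–7.2, Thm. 7.3, §13.2; [Lang1990] Ch. 5 §2. Tree: `…SlopeSeparationTieRadius`
(`not_hasSum_zero_of_uniqueMax`), `…SlopeSeparation` (`exists_common_zero_of_span_distinguished`),
`Literature/…/IwasawaAlgebraStructureProofs` (`eq_span_of_height_eq_one`), `Rank1Residual/X1/MuLambdaAlgebra`.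
-/

set_option autoImplicit false
-- justification: the mandated namespace `Summit.BirchSwinnertonDyer.BirchSwinnertonDyer.Theorems`
-- (single-conjunct summit, Sub = Summit) repeats a segment by design (D-0017).
set_option linter.dupNamespace false

noncomputable section

open scoped Classical

open Polynomial Literature.NumberTheory.EllipticCurves
  Summit.BirchSwinnertonDyer.Rank1Residual.X1.MuLambda
  Summit.BirchSwinnertonDyer.Rank1Residual.Iwasawa
  Summit.BirchSwinnertonDyer.BirchSwinnertonDyer.Theorems.ChromaticSlopeSeparation

namespace Summit.BirchSwinnertonDyer.BirchSwinnertonDyer.Theorems.ChromaticNewtonPolygon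

/-! ## §1. Combinatorics of a vertex list and two real-number lemmas -/

section Combinatorics

/-- Every index `k ≤ n_m` is a vertex `n_t` (`t ≤ m`) or lies strictly inside a segment `n_t < k < n_{t+1}`
(`t < m`), for a vertex list with `n_0 = 0` (take the last vertex `n_t ≤ k`). [folklore] -/
theorem exists_vertex_or_interior {n : ℕ → ℕ} {m : ℕ} (hn0 : n 0 = 0) {k : ℕ} (hk : k ≤ n m) :
    (∃ t, t ≤ m ∧ k = n t) ∨ (∃ t, t < m ∧ n t < k ∧ k < n (t + 1)) := by
  set t₀ := Nat.findGreatest (fun t ↦ n t ≤ k) m with ht₀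
  have hP0 : n 0 ≤ k := by rw [hn0]; exact Nat.zero_le _
  have ht₀le : t₀ ≤ m := Nat.findGreatest_le m
  have ht₀P : n t₀ ≤ k := Nat.findGreatest_spec (P := fun t ↦ n t ≤ k) (Nat.zero_le m) hP0
  rcases ht₀P.eq_or_lt with h | h
  · exact Or.inl ⟨t₀, ht₀le, h.symm⟩
  · right
    have ht₀m : t₀ < m := by
      rcases ht₀le.eq_or_lt with h' | h'
      · exfalso; rw [h'] at h; exact absurd hk (not_le.mpr h)
      · exact h'
    refine ⟨t₀, ht₀m, h, ?_⟩
    by_contra hle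
    rw [not_lt] at hle
    exact Nat.findGreatest_is_greatest (P := fun t ↦ n t ≤ k) (Nat.lt_succ_self t₀)
      (Nat.succ_le_of_lt ht₀m) hle

/-- An increasing chain: `w t < w (t+1)` for all `t < a` gives `w t < w a` for `t < a`. [folklore] -/
theorem lt_of_chain_up {w : ℕ → ℝ} {a : ℕ} (hup : ∀ t, t < a → w t < w (t + 1)) :
    ∀ t, t < a → w t < w a := by
  intro t ht
  obtain ⟨d, rfl⟩ : ∃ d, a = t + d + 1 := ⟨a - t - 1, by omega⟩
  induction d with
  | zero => simpa using hup t (by omega)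
  | succ d ih =>
    have h1 : w t < w (t + d + 1) := ih (fun s hs ↦ hup s (by omega)) (by omega)
    have h2 : w (t + d + 1) < w (t + d + 1 + 1) := hup (t + d + 1) (by omega)
    rw [show t + (d + 1) + 1 = t + d + 1 + 1 by omega]
    exact lt_trans h1 h2

/-- A decreasing chain: `w (t+1) < w t` for `a ≤ t < m` gives `w t < w a` for `a < t ≤ m`. [folklore] -/
theorem lt_of_chain_down {w : ℕ → ℝ} {a m : ℕ} (hdown : ∀ t, a ≤ t → t < m → w (t + 1) < w t) :
    ∀ t, a < t → t ≤ m → w t < w a := by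
  intro t hat htm
  obtain ⟨d, rfl⟩ : ∃ d, t = a + d + 1 := ⟨t - a - 1, by omega⟩
  induction d with
  | zero => simpa using hdown a le_rfl (by omega)
  | succ d ih =>
    have h1 : w (a + d + 1) < w a := ih (by omega) (by omega)
    have h2 : w (a + d + 1 + 1) < w (a + d + 1) := hdown (a + d + 1) (by omega) (by omega)
    rw [show a + (d + 1) + 1 = a + d + 1 + 1 by omega]
    exact lt_trans h2 h1

/-- **Interior terms are dominated** (log-linear form): for `n₀ < k < n₁`, the chord bound
`(n₁ − n₀)u_k ≤ (n₁ − k)u₀ + (k − n₀)u₁` and `u₀ + n₀L ≠ u₁ + n₁L` give `u_k + kL < max (u₀ + n₀L) (u₁ + n₁L)`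
(as `(n₁ − n₀)k = (n₁ − k)n₀ + (k − n₀)n₁`). [cite: Koblitz1984, Ch. IV §3 Lemma 4] -/
theorem interior_lt_max {uk u0 u1 L : ℝ} {n0 k n1 : ℕ} (h0 : n0 < k) (h1 : k < n1)
    (habove : ((n1 : ℝ) - n0) * uk ≤ ((n1 : ℝ) - k) * u0 + ((k : ℝ) - n0) * u1)
    (hne : u0 + n0 * L ≠ u1 + n1 * L) :
    uk + k * L < max (u0 + n0 * L) (u1 + n1 * L) := by
  have ha : (0 : ℝ) < (n1 : ℝ) - k := sub_pos.mpr (by exact_mod_cast h1)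
  have hb : (0 : ℝ) < (k : ℝ) - n0 := sub_pos.mpr (by exact_mod_cast h0)
  have hΔ : (0 : ℝ) < (n1 : ℝ) - n0 := by linarith
  have key : ((n1 : ℝ) - n0) * (uk + k * L) ≤
      ((n1 : ℝ) - k) * (u0 + n0 * L) + ((k : ℝ) - n0) * (u1 + n1 * L) := by
    linear_combination habove
  rcases lt_or_gt_of_ne hne with hlt | hgt
  · rw [max_eq_right hlt.le]
    have h2 := mul_lt_mul_of_pos_left hlt ha
    have h3 : ((n1 : ℝ) - n0) * (uk + k * L) < ((n1 : ℝ) - n0) * (u1 + n1 * L) := by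
      linear_combination key + h2
    exact lt_of_mul_lt_mul_left h3 hΔ.le
  · rw [max_eq_left hgt.le]
    have h2 := mul_lt_mul_of_pos_left hgt hb
    have h3 : ((n1 : ℝ) - n0) * (uk + k * L) < ((n1 : ℝ) - n0) * (u0 + n0 * L) := by
      linear_combination key + h2
    exact lt_of_mul_lt_mul_left h3 hΔ.le

end Combinatorics

variable {p : ℕ} [hp : Fact p.Prime]

/-! ## §2. The Newton polygon theorem: zeros lie on edge circles -/

section NewtonPolygon

/-- **THE NEWTON POLYGON OF A POWER SERIES (robust form).** `G ∈ Λ`, `G ≠ 0`, `μ(G) = 0`, with a HULL DATUM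
(vertices `n₀ = 0 < ⋯ < n_m = λ(G)`, `G_{n_t} ≠ 0`, interior indices on or above the chords, consecutive slopes
non-increasing — see the module docstring): every zero `0 < |z| < 1` of `G` lies on an EDGE circle,
`|z|^{n_{t+1}−n_t}·‖G_{n_{t+1}}‖ = ‖G_{n_t}‖` for some `t < m`. [cite: Koblitz1984, Ch. IV §3 Lemma 4 and §4]
[cite: Washington1997, §7.1–7.2 and Thm. 7.3] -/
theorem exists_edge_of_hasSum_zero {G : IwasawaAlgebra p} (hG0 : G ≠ 0) (hμ : mu G = 0)
    {m : ℕ} {n : ℕ → ℕ} (hn0 : n 0 = 0) (hnm : n m = lam G) (hmono : ∀ t, t < m → n t < n (t + 1))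
    (hvert : ∀ t, t ≤ m → PowerSeries.coeff (n t) G ≠ 0)
    (habove : ∀ t, t < m → ∀ k, n t < k → k < n (t + 1) →
      ‖PowerSeries.coeff k G‖ ^ (n (t + 1) - n t) ≤
        ‖PowerSeries.coeff (n t) G‖ ^ (n (t + 1) - k) * ‖PowerSeries.coeff (n (t + 1)) G‖ ^ (k - n t))
    (hconv : ∀ t, t + 2 ≤ m →
      ‖PowerSeries.coeff (n t) G‖ ^ (n (t + 2) - n (t + 1)) *
          ‖PowerSeries.coeff (n (t + 2)) G‖ ^ (n (t + 1) - n t) ≤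
        ‖PowerSeries.coeff (n (t + 1)) G‖ ^ (n (t + 2) - n t))
    {z : ℂ_[p]} (hz : ‖z‖ < 1) (hz0 : 0 < ‖z‖)
    (hsum : HasSum (fun k ↦ ((algebraMap ℚ_[p] ℂ_[p]).comp (algebraMap ℤ_[p] ℚ_[p]))
      (PowerSeries.coeff k G) * z ^ k) 0) :
    ∃ t, t < m ∧ ‖z‖ ^ (n (t + 1) - n t) * ‖PowerSeries.coeff (n (t + 1)) G‖ =
      ‖PowerSeries.coeff (n t) G‖ := by
  by_contra hcon
  push Not at hcon
  set s : ℝ := ‖z‖ with hs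
  set g : ℕ → ℝ := fun k ↦ ‖PowerSeries.coeff k G‖ with hg
  set L : ℝ := Real.log s with hL
  -- the vertex terms, in logarithms
  set w : ℕ → ℝ := fun t ↦ Real.log (g (n t)) + (n t : ℝ) * L with hw
  have hgpos : ∀ t, t ≤ m → 0 < g (n t) := fun t ht ↦ norm_pos_iff.mpr (hvert t ht)
  have hmono' : ∀ t, t < m → (n t : ℝ) < n (t + 1) := fun t ht ↦ by exact_mod_cast hmono t ht
  have hcast : ∀ t, t < m → ((n (t + 1) - n t : ℕ) : ℝ) = (n (t + 1) : ℝ) - n t :=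
    fun t ht ↦ by rw [Nat.cast_sub (hmono t ht).le]
  -- (a) consecutive vertex terms never tie (else `z` is on that edge circle)
  have hd : ∀ t, t < m → w (t + 1) ≠ w t := by
    intro t ht heq
    apply hcon t ht
    have h1 : Real.log (s ^ (n (t + 1) - n t) * g (n (t + 1))) = Real.log (g (n t)) := by
      rw [Real.log_mul (pow_pos hz0 _).ne' (hgpos (t + 1) (by omega)).ne', Real.log_pow, hcast t ht]
      have h2 : Real.log (g (n (t + 1))) + (n (t + 1) : ℝ) * L = Real.log (g (n t)) + (n t : ℝ) * L := heq
      linear_combination h2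
    exact Real.log_injOn_pos (Set.mem_Ioi.mpr (mul_pos (pow_pos hz0 _) (hgpos _ (by omega))))
      (Set.mem_Ioi.mpr (hgpos t ht.le)) h1
  -- (b) convexity propagates a descent
  have hprop : ∀ t, t + 2 ≤ m → w (t + 1) < w t → w (t + 2) < w (t + 1) := by
    intro t ht hlt
    have hpos0 := hgpos t (by omega)
    have hpos2 := hgpos (t + 2) (by omega)
    have hc := hconv t ht
    have hclog : ((n (t + 2) - n (t + 1) : ℕ) : ℝ) * Real.log (g (n t)) +
        ((n (t + 1) - n t : ℕ) : ℝ) * Real.log (g (n (t + 2))) ≤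
        ((n (t + 2) - n t : ℕ) : ℝ) * Real.log (g (n (t + 1))) := by
      have h := Real.log_le_log (mul_pos (pow_pos hpos0 _) (pow_pos hpos2 _)) hc
      rwa [Real.log_mul (pow_pos hpos0 _).ne' (pow_pos hpos2 _).ne', Real.log_pow, Real.log_pow,
        Real.log_pow] at h
    have e1 : ((n (t + 2) - n (t + 1) : ℕ) : ℝ) = (n (t + 2) : ℝ) - n (t + 1) := hcast (t + 1) (by omega)
    have e2 : ((n (t + 1) - n t : ℕ) : ℝ) = (n (t + 1) : ℝ) - n t := hcast t (by omega)
    have e3 : ((n (t + 2) - n t : ℕ) : ℝ) = (n (t + 2) : ℝ) - n t := by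
      have h01 : n t < n (t + 1) := hmono t (by omega)
      have h12 : n (t + 1) < n (t + 2) := hmono (t + 1) (by omega)
      rw [Nat.cast_sub (by omega)]
    rw [e1, e2, e3] at hclog
    have hΔ0 : (0 : ℝ) < (n (t + 1) : ℝ) - n t := sub_pos.mpr (hmono' t (by omega))
    have hΔ1 : (0 : ℝ) < (n (t + 2) : ℝ) - n (t + 1) := sub_pos.mpr (hmono' (t + 1) (by omega))
    have hlt' : Real.log (g (n (t + 1))) + (n (t + 1) : ℝ) * L < Real.log (g (n t)) + (n t : ℝ) * L := hlt
    have h1 := mul_lt_mul_of_pos_left hlt' hΔ1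
    have h3 : ((n (t + 1) : ℝ) - n t) * (Real.log (g (n (t + 2))) + (n (t + 2) : ℝ) * L) <
        ((n (t + 1) : ℝ) - n t) * (Real.log (g (n (t + 1))) + (n (t + 1) : ℝ) * L) := by
      linear_combination h1 + hclog
    exact lt_of_mul_lt_mul_left h3 hΔ0.le
  -- (c) the peak vertex `a`: first descent (or `m`)
  have hex : ∃ a, m ≤ a ∨ w (a + 1) < w a := ⟨m, Or.inl le_rfl⟩
  set a := Nat.find hex with ha
  have haP : m ≤ a ∨ w (a + 1) < w a := Nat.find_spec hex
  have hamin : ∀ t, t < a → ¬ (m ≤ t ∨ w (t + 1) < w t) := fun t ht ↦ Nat.find_min hex ht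
  have ham : a ≤ m := by by_contra h; exact hamin m (not_le.mp h) (Or.inl le_rfl)
  have hup : ∀ t, t < a → w t < w (t + 1) := by
    intro t ht
    have h := hamin t ht
    push Not at h
    exact lt_of_le_of_ne h.2 (hd t h.1).symm
  have hdown : ∀ t, a ≤ t → t < m → w (t + 1) < w t := by
    intro t hat htm
    obtain ⟨d, rfl⟩ : ∃ d, t = a + d := ⟨t - a, by omega⟩
    induction d with
    | zero => simpa using haP.resolve_left (by omega)
    | succ d ih =>
      have h1 : w (a + d + 1) < w (a + d) := ih (by omega) (by omega)
      have h2 : w (a + d + 2) < w (a + d + 1) := hprop (a + d) (by omega) h1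
      rw [show a + (d + 1) = a + d + 1 by omega]
      exact h2
  have hpeak : ∀ t, t ≤ m → t ≠ a → w t < w a := fun t ht hta ↦
    (lt_or_gt_of_ne hta).elim (fun h ↦ lt_of_chain_up hup t h) (fun h ↦ lt_of_chain_down hdown t h ht)
  have hpeak' : ∀ t, t ≤ m → w t ≤ w a := by
    intro t ht
    by_cases hta : t = a
    · rw [hta]
    · exact (hpeak t ht hta).le
  -- (d) the vertex term `n a` strictly dominates every term of index `≤ λ(G)`
  have hTa : 0 < g (n a) * s ^ (n a) := mul_pos (hgpos a ham) (pow_pos hz0 _)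
  have hlogTa : Real.log (g (n a) * s ^ (n a)) = w a := by
    rw [Real.log_mul (hgpos a ham).ne' (pow_pos hz0 _).ne', Real.log_pow]
  have hdom : ∀ k, k ≤ lam G → k ≠ n a →
      ‖PowerSeries.coeff k G‖ * ‖z‖ ^ k < ‖PowerSeries.coeff (n a) G‖ * ‖z‖ ^ (n a) := by
    intro k hk hka
    change g k * s ^ k < g (n a) * s ^ (n a)
    by_cases hk0 : PowerSeries.coeff k G = 0
    · rw [show g k = 0 by simp only [hg, hk0, norm_zero], zero_mul]
      exact hTa
    · have hgk : 0 < g k := norm_pos_iff.mpr hk0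
      rw [← Real.log_lt_log_iff (mul_pos hgk (pow_pos hz0 _)) hTa, hlogTa,
        Real.log_mul hgk.ne' (pow_pos hz0 _).ne', Real.log_pow]
      have hk' : k ≤ n m := by rw [hnm]; exact hk
      rcases exists_vertex_or_interior hn0 hk' with ⟨t, htm, rfl⟩ | ⟨t, htm, h1, h2⟩
      · exact hpeak t htm (fun h ↦ hka (by rw [h]))
      · have hab := habove t htm k h1 h2
        have hablog : ((n (t + 1) - n t : ℕ) : ℝ) * Real.log (g k) ≤
            ((n (t + 1) - k : ℕ) : ℝ) * Real.log (g (n t)) + ((k - n t : ℕ) : ℝ) * Real.log (g (n (t + 1))) := by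
          have h := Real.log_le_log (pow_pos hgk _) hab
          rwa [Real.log_mul (pow_pos (hgpos t htm.le) _).ne' (pow_pos (hgpos (t + 1) (by omega)) _).ne',
            Real.log_pow, Real.log_pow, Real.log_pow] at h
        rw [hcast t htm, Nat.cast_sub h2.le, Nat.cast_sub h1.le] at hablog
        calc Real.log (g k) + (k : ℝ) * L
            < max (Real.log (g (n t)) + (n t : ℝ) * L) (Real.log (g (n (t + 1))) + (n (t + 1) : ℝ) * L) :=
              interior_lt_max h1 h2 hablog (hd t htm).symm
          _ ≤ w a := max_le (hpeak' t htm.le) (hpeak' (t + 1) (by omega))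
  exact not_hasSum_zero_of_uniqueMax hG0 hμ hz hz0 hdom hsum

end NewtonPolygon

/-! ## §3. Two functions: the hull datum of `G` and a unique dominant term of `F` at every EDGE radius -/

section TwoFunctions

/-- **NEWTON-POLYGON SEPARATION ⟹ no common zero.** `F, G ∈ Λ ∖ {0}`, `μ(F) = μ(G) = 0`, `F(0) ≠ 0`, the hull
datum for `G`, and for every EDGE `t < m` an index `k₀ ≤ λ(F)` with, for all `k ≤ λ(F)`, `k ≠ k₀`,
`‖F_k‖^{n_{t+1}−n_t}‖G_{n_t}‖^k‖G_{n_{t+1}}‖^{k₀} < ‖F_{k₀}‖^{n_{t+1}−n_t}‖G_{n_t}‖^{k₀}‖G_{n_{t+1}}‖^k` (the term `k₀` of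
`F` strictly dominates at the edge radius, cleared of roots): no common zero of `F, G` in the open unit disc of
`ℂ_p`. [cite: Koblitz1984, Ch. IV §4] [cite: Washington1997, §7.1–7.2 and Thm. 7.3] -/
theorem not_common_zero_of_newtonPolygon {F G : IwasawaAlgebra p} (hF0 : F ≠ 0) (hG0 : G ≠ 0)
    (hμF : mu F = 0) (hμG : mu G = 0) (hFc : PowerSeries.constantCoeff F ≠ 0)
    {m : ℕ} {n : ℕ → ℕ} (hn0 : n 0 = 0) (hnm : n m = lam G) (hmono : ∀ t, t < m → n t < n (t + 1))
    (hvert : ∀ t, t ≤ m → PowerSeries.coeff (n t) G ≠ 0)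
    (habove : ∀ t, t < m → ∀ k, n t < k → k < n (t + 1) →
      ‖PowerSeries.coeff k G‖ ^ (n (t + 1) - n t) ≤
        ‖PowerSeries.coeff (n t) G‖ ^ (n (t + 1) - k) * ‖PowerSeries.coeff (n (t + 1)) G‖ ^ (k - n t))
    (hconv : ∀ t, t + 2 ≤ m →
      ‖PowerSeries.coeff (n t) G‖ ^ (n (t + 2) - n (t + 1)) *
          ‖PowerSeries.coeff (n (t + 2)) G‖ ^ (n (t + 1) - n t) ≤
        ‖PowerSeries.coeff (n (t + 1)) G‖ ^ (n (t + 2) - n t))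
    (hsep : ∀ t, t < m → ∃ k₀, k₀ ≤ lam F ∧ ∀ k, k ≤ lam F → k ≠ k₀ →
      ‖PowerSeries.coeff k F‖ ^ (n (t + 1) - n t) * ‖PowerSeries.coeff (n t) G‖ ^ k *
          ‖PowerSeries.coeff (n (t + 1)) G‖ ^ k₀ <
        ‖PowerSeries.coeff k₀ F‖ ^ (n (t + 1) - n t) * ‖PowerSeries.coeff (n t) G‖ ^ k₀ *
          ‖PowerSeries.coeff (n (t + 1)) G‖ ^ k)
    {z : ℂ_[p]} (hz : ‖z‖ < 1)
    (hFz : HasSum (fun k ↦ ((algebraMap ℚ_[p] ℂ_[p]).comp (algebraMap ℤ_[p] ℚ_[p]))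
      (PowerSeries.coeff k F) * z ^ k) 0)
    (hGz : HasSum (fun k ↦ ((algebraMap ℚ_[p] ℂ_[p]).comp (algebraMap ℤ_[p] ℚ_[p]))
      (PowerSeries.coeff k G) * z ^ k) 0) : False := by
  set ιZ : ℤ_[p] →+* ℂ_[p] := (algebraMap ℚ_[p] ℂ_[p]).comp (algebraMap ℤ_[p] ℚ_[p]) with hιZ
  set s : ℝ := ‖z‖ with hs
  have hs0 : 0 ≤ s := norm_nonneg _
  -- `z ≠ 0`: `F(0) = F_0 ≠ 0`
  have hz0 : 0 < s := by
    by_contra hle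
    rw [not_lt] at hle
    have hz00 : z = 0 := norm_eq_zero.mp (le_antisymm hle hs0)
    have hF00 : HasSum (fun k ↦ ιZ (PowerSeries.coeff k F) * z ^ k) (ιZ (PowerSeries.coeff 0 F)) := by
      have h := hasSum_single (f := fun k ↦ ιZ (PowerSeries.coeff k F) * z ^ k) 0 (fun k hk ↦ by
        rw [hz00, zero_pow hk, mul_zero])
      simpa [hz00] using h
    have heq := hFz.unique hF00
    rw [PowerSeries.coeff_zero_eq_constantCoeff_apply] at heq
    exact hFc (injective_algebraMap_comp (a₁ := PowerSeries.constantCoeff F) (a₂ := 0)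
      (by rw [map_zero]; exact heq.symm))
  -- a zero of `G` lies on an edge circle `t`
  obtain ⟨t, ht, hedge⟩ := exists_edge_of_hasSum_zero hG0 hμG hn0 hnm hmono hvert habove hconv hz hz0 hGz
  obtain ⟨k₀, -, hdom⟩ := hsep t ht
  have hGipos : 0 < ‖PowerSeries.coeff (n t) G‖ := norm_pos_iff.mpr (hvert t ht.le)
  have hGjpos : 0 < ‖PowerSeries.coeff (n (t + 1)) G‖ := norm_pos_iff.mpr (hvert (t + 1) (by omega))
  -- translate the certificate at the edge radius `s^{n_{t+1} − n_t} = ‖G_{n_t}‖ / ‖G_{n_{t+1}}‖`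
  have hdom' : ∀ k, k ≤ lam F → k ≠ k₀ →
      ‖PowerSeries.coeff k F‖ * s ^ k < ‖PowerSeries.coeff k₀ F‖ * s ^ k₀ := by
    intro k hk hkk
    have h := hdom k hk hkk
    refine lt_of_pow_lt_pow_left₀ (n (t + 1) - n t) (mul_nonneg (norm_nonneg _) (pow_nonneg hs0 _)) ?_
    have hGjk : 0 < ‖PowerSeries.coeff (n (t + 1)) G‖ ^ (k + k₀) := pow_pos hGjpos _
    refine lt_of_mul_lt_mul_right ?_ hGjk.le
    have e1 : (‖PowerSeries.coeff k F‖ * s ^ k) ^ (n (t + 1) - n t) *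
          ‖PowerSeries.coeff (n (t + 1)) G‖ ^ (k + k₀) =
        ‖PowerSeries.coeff k F‖ ^ (n (t + 1) - n t) * ‖PowerSeries.coeff (n t) G‖ ^ k *
          ‖PowerSeries.coeff (n (t + 1)) G‖ ^ k₀ := by
      rw [← hedge]; ring
    have e2 : (‖PowerSeries.coeff k₀ F‖ * s ^ k₀) ^ (n (t + 1) - n t) *
          ‖PowerSeries.coeff (n (t + 1)) G‖ ^ (k + k₀) =
        ‖PowerSeries.coeff k₀ F‖ ^ (n (t + 1) - n t) * ‖PowerSeries.coeff (n t) G‖ ^ k₀ *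
          ‖PowerSeries.coeff (n (t + 1)) G‖ ^ k := by
      rw [← hedge]; ring
    rw [e1, e2]
    exact h
  exact not_hasSum_zero_of_uniqueMax hF0 hμF hz hz0 hdom' hFz

/-- **NEWTON-POLYGON SEPARATION ⟹ no common height-one prime of `Λ`** (`(p)` by `μ(F) = 0`; `(f)` by its common
zero in `ℂ_p`). [cite: Koblitz1984, Ch. IV §4] [cite: Washington1997, §7.1–7.2, Thm. 7.3 and §13.2] -/
theorem not_mem_and_mem_of_newtonPolygon {F G : IwasawaAlgebra p} (hF0 : F ≠ 0) (hG0 : G ≠ 0)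
    (hμF : mu F = 0) (hμG : mu G = 0) (hFc : PowerSeries.constantCoeff F ≠ 0)
    {m : ℕ} {n : ℕ → ℕ} (hn0 : n 0 = 0) (hnm : n m = lam G) (hmono : ∀ t, t < m → n t < n (t + 1))
    (hvert : ∀ t, t ≤ m → PowerSeries.coeff (n t) G ≠ 0)
    (habove : ∀ t, t < m → ∀ k, n t < k → k < n (t + 1) →
      ‖PowerSeries.coeff k G‖ ^ (n (t + 1) - n t) ≤
        ‖PowerSeries.coeff (n t) G‖ ^ (n (t + 1) - k) * ‖PowerSeries.coeff (n (t + 1)) G‖ ^ (k - n t))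
    (hconv : ∀ t, t + 2 ≤ m →
      ‖PowerSeries.coeff (n t) G‖ ^ (n (t + 2) - n (t + 1)) *
          ‖PowerSeries.coeff (n (t + 2)) G‖ ^ (n (t + 1) - n t) ≤
        ‖PowerSeries.coeff (n (t + 1)) G‖ ^ (n (t + 2) - n t))
    (hsep : ∀ t, t < m → ∃ k₀, k₀ ≤ lam F ∧ ∀ k, k ≤ lam F → k ≠ k₀ →
      ‖PowerSeries.coeff k F‖ ^ (n (t + 1) - n t) * ‖PowerSeries.coeff (n t) G‖ ^ k *
          ‖PowerSeries.coeff (n (t + 1)) G‖ ^ k₀ <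
        ‖PowerSeries.coeff k₀ F‖ ^ (n (t + 1) - n t) * ‖PowerSeries.coeff (n t) G‖ ^ k₀ *
          ‖PowerSeries.coeff (n (t + 1)) G‖ ^ k)
    (𝔭 : PrimeSpectrum (IwasawaAlgebra p)) (h𝔭 : 𝔭.asIdeal.height = 1) :
    ¬ (F ∈ 𝔭.asIdeal ∧ G ∈ 𝔭.asIdeal) := by
  rintro ⟨hF𝔭, hG𝔭⟩
  rcases IwasawaAlgebra.eq_span_of_height_eq_one p 𝔭.asIdeal h𝔭 with hp𝔭 | ⟨f, hf, hirr, hf𝔭⟩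
  · rw [hp𝔭, Ideal.mem_span_singleton] at hF𝔭
    have h1 : 1 ≤ mu F := le_mu_of_C_pow_dvd hF0 (by rwa [pow_one])
    omega
  · obtain ⟨z, hz, hzero⟩ := exists_common_zero_of_span_distinguished hf hirr
    rw [hf𝔭] at hF𝔭 hG𝔭
    exact not_common_zero_of_newtonPolygon hF0 hG0 hμF hμG hFc hn0 hnm hmono hvert habove hconv hsep hz
      (hzero F hF𝔭) (hzero G hG𝔭)

/-- **The `T`-shifted form** (off `(T)`; analytic rank one: `F = T·F₁`, `G = T·G₁`, the data for `(F₁, G₁)`).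
[cite: Washington1997, §7.1–7.2, Thm. 7.3 and §13.2] -/
theorem not_mem_and_mem_of_X_mul_of_newtonPolygon {F G F₁ G₁ : IwasawaAlgebra p}
    (hFF : F = PowerSeries.X * F₁) (hGG : G = PowerSeries.X * G₁) (hF0 : F₁ ≠ 0) (hG0 : G₁ ≠ 0)
    (hμF : mu F₁ = 0) (hμG : mu G₁ = 0) (hFc : PowerSeries.constantCoeff F₁ ≠ 0)
    {m : ℕ} {n : ℕ → ℕ} (hn0 : n 0 = 0) (hnm : n m = lam G₁) (hmono : ∀ t, t < m → n t < n (t + 1))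
    (hvert : ∀ t, t ≤ m → PowerSeries.coeff (n t) G₁ ≠ 0)
    (habove : ∀ t, t < m → ∀ k, n t < k → k < n (t + 1) →
      ‖PowerSeries.coeff k G₁‖ ^ (n (t + 1) - n t) ≤
        ‖PowerSeries.coeff (n t) G₁‖ ^ (n (t + 1) - k) * ‖PowerSeries.coeff (n (t + 1)) G₁‖ ^ (k - n t))
    (hconv : ∀ t, t + 2 ≤ m →
      ‖PowerSeries.coeff (n t) G₁‖ ^ (n (t + 2) - n (t + 1)) *
          ‖PowerSeries.coeff (n (t + 2)) G₁‖ ^ (n (t + 1) - n t) ≤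
        ‖PowerSeries.coeff (n (t + 1)) G₁‖ ^ (n (t + 2) - n t))
    (hsep : ∀ t, t < m → ∃ k₀, k₀ ≤ lam F₁ ∧ ∀ k, k ≤ lam F₁ → k ≠ k₀ →
      ‖PowerSeries.coeff k F₁‖ ^ (n (t + 1) - n t) * ‖PowerSeries.coeff (n t) G₁‖ ^ k *
          ‖PowerSeries.coeff (n (t + 1)) G₁‖ ^ k₀ <
        ‖PowerSeries.coeff k₀ F₁‖ ^ (n (t + 1) - n t) * ‖PowerSeries.coeff (n t) G₁‖ ^ k₀ *
          ‖PowerSeries.coeff (n (t + 1)) G₁‖ ^ k)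
    (𝔭 : PrimeSpectrum (IwasawaAlgebra p)) (h𝔭 : 𝔭.asIdeal.height = 1)
    (hT : (PowerSeries.X : IwasawaAlgebra p) ∉ 𝔭.asIdeal) :
    ¬ (F ∈ 𝔭.asIdeal ∧ G ∈ 𝔭.asIdeal) := by
  rintro ⟨hF𝔭, hG𝔭⟩
  rw [hFF] at hF𝔭
  rw [hGG] at hG𝔭
  exact not_mem_and_mem_of_newtonPolygon hF0 hG0 hμF hμG hFc hn0 hnm hmono hvert habove hconv hsep 𝔭 h𝔭
    ⟨(𝔭.isPrime.mem_or_mem hF𝔭).resolve_left hT, (𝔭.isPrime.mem_or_mem hG𝔭).resolve_left hT⟩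

end TwoFunctions

end Summit.BirchSwinnertonDyer.BirchSwinnertonDyer.Theorems.ChromaticNewtonPolygon

end
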